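import Summits.Ventures.Crystal3D.Theorems.StickyWulffConstantGenericWallFloorCubicCoords
import Summits.Ventures.Crystal3D.Theorems.StickyWulffConstantGenericWallFloorNonSaturationCoincidence
import Summits.Ventures.Crystal3D.Theorems.StickyWulffConstantGenericWallFloorCredits
import Summits.Ventures.Crystal3D.Theorems.StickyWulffConstantGenericWallFloorCoaxialCriterion
import HarnessLib

/-!
# Near-identity cap lemma for mixed kissing dozens, part 3: lattice form (module M7 of the rigid rung, Σ1)

HONEST FRAMING. Part of the venture `Summits/Ventures/Crystal3D` (cell `crystal3d-full`), helper
`--supports` the crux `GenericWallFloor` (stmt-Ventures-19480, `route-Ventures-StickyWulffConstant`),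
REGISTERED line `WallLedgerG`, stub `stub_twoSlabAdhesion`, rigid-bicrystal rung, module M7 (coincidence
top sites).  Rung credit only.  Packages the cubic-frame cap lemma `near_identity_cut`
(`…GenericWallFloorCutNormals`) in the vocabulary of `TwoSlabAdhesion` / `…SiteLedger`:

**`coincidence_top_unsaturated_near_identity`.**  `Λ₁ = A₁·Λ₀ + t₁`, `Λ₂ = A₂·Λ₀ + t₂` NOT co-axial but
CLOSE — `‖A₂ w − A₁ w‖ ≤ 1/12` for every slot `w ∈ fccSlots` (misorientation within ≈ 6° of the identity;
a caller symmetrises `A₂` by a lattice isometry first); `X` `1`-separated with the neighbours of `p` on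
`Λ₁ ∪ Λ₂`; `p ∈ Λ₁ ∩ Λ₂` a COINCIDENCE ball which is a top for `Λ₁` (`p + A₁u ∉ X`, `p − A₁u ∈ X`).  Then
`#{q ∈ X : dist p q = 1} ≤ 11` — exactly the shape of the non-saturation hypothesis of the rigid rung
(`…RigidRung`, `…GrainLedger`) at coincidence sites, for near-identity pairs.

Plumbing: orthonormal cubic coordinates `cubicCoords` (Parseval `inner_eq_cubicCoords` from
`two_mul_norm_sq_eq_cubic` by polarisation), the cubic frame `cubicFrame`, the matrix of a linear
isometry in that frame (`cubicCoords_map`, `cubicMatrix_orthogonal/horth/frob`), the twelve slots as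
lattice vectors `slotSite` with `cubicCoords (slotSite k) = slotVec k`; then: saturated ⇒ `4 ≤ #own ≤ 8`
(`four_le_card_empty_of_saturated_coincidence_top`), every empty own slot has its foreign twin occupied
(counting: foreign neighbours sit on `Λ₂`-slots and never on the twin of an occupied own slot, which is
`≤ 1/12 < 1` away), `0 < ‖κ‖_F² ≤ 1/24` (`κ = 0` would make `A₂ = A₁`, co-axial by `coaxial_of_image_eq`),
and `near_identity_cut` produces an own ball and a foreign ball at distance `< 1`.
WHAT THIS IS NOT: the Σ3 cap (near-twin pairs), the global part of M7, the symmetrisation over the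
lattice point group; rung F-C1 not moved.
-/

noncomputable section

namespace Summit.Ventures.Crystal3D.Theorems

open Summit.Ventures.Crystal3D Finset Matrix NearIdentity
open Literature.MathematicalPhysics.StatisticalMechanics (barlowPos barlowStacking fccStacking
  constHagg IsHaggSeq haggLabel_const barlowPos_mem)
open scoped InnerProductSpace

open scoped Classical in
/-- **Σ1 CAP LEMMA, lattice form: coincidence tops of a near-identity pair are unsaturated.**
Let `Λ₁ = A₁·Λ₀ + t₁`, `Λ₂ = A₂·Λ₀ + t₂` be NOT co-axial but CLOSE: `‖A₂ w − A₁ w‖ ≤ 1/12` for every slot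
`w` (misorientation within `≈ 6°` of the identity; callers symmetrise by a lattice isometry).  Let `X`
be `1`-separated with all neighbours of `p` on `Λ₁ ∪ Λ₂` (rigid bicrystal), and `p ∈ Λ₁ ∩ Λ₂` a
COINCIDENCE ball which is a top for `Λ₁` (`p + A₁u ∉ X`, `p − A₁u ∈ X`).  Then `p` has at most eleven
contacts.  Proof: by `four_le_card_empty_of_saturated_coincidence_top` a saturated `p` has `4 ≤ #own ≤ 8`;
every empty own slot `w` has its foreign twin `p + A₂w` occupied (the foreign neighbours sit on
`Λ₂`-slots, never on the twin of an occupied own slot, which is `≤ 1/12` away); the cubic-frame matrix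
`1 + κ` of `A₁⁻¹A₂` is orthogonal with `0 < ‖κ‖_F² ≤ 1/24`; `near_identity_cut` yields an own ball and a
foreign ball closer than `1`. -/
theorem coincidence_top_unsaturated_near_identity
    (A₁ A₂ : EuclideanSpace ℝ (Fin 3) ≃ₗᵢ[ℝ] EuclideanSpace ℝ (Fin 3))
    (t₁ t₂ p u : EuclideanSpace ℝ (Fin 3)) (X : Finset (EuclideanSpace ℝ (Fin 3)))
    (hnc : ¬ ∃ (L : EuclideanSpace ℝ (Fin 3) ≃ₗᵢ[ℝ] EuclideanSpace ℝ (Fin 3))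
        (s₁ s₂ : EuclideanSpace ℝ (Fin 3)) (σ σ' : ℤ → ℤ), IsHaggSeq σ ∧ IsHaggSeq σ' ∧
        (fun x => A₁ x + t₁) '' fccStacking 1 (Real.sqrt (2 / 3)) ⊆
          (fun x => L x + s₁) '' barlowStacking 1 (Real.sqrt (2 / 3)) σ ∧
        (fun x => A₂ x + t₂) '' fccStacking 1 (Real.sqrt (2 / 3)) ⊆
          (fun x => L x + s₂) '' barlowStacking 1 (Real.sqrt (2 / 3)) σ')
    (hp₁ : p ∈ (fun x => A₁ x + t₁) '' fccStacking 1 (Real.sqrt (2 / 3)))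
    (hp₂ : p ∈ (fun x => A₂ x + t₂) '' fccStacking 1 (Real.sqrt (2 / 3)))
    (hsep : ∀ x ∈ X, ∀ y ∈ X, x ≠ y → 1 ≤ dist x y)
    (hX : ∀ q ∈ X, dist p q = 1 → q ∈ (fun x => A₁ x + t₁) '' fccStacking 1 (Real.sqrt (2 / 3)) ∨
      q ∈ (fun x => A₂ x + t₂) '' fccStacking 1 (Real.sqrt (2 / 3)))
    (hu : u ∈ fccSlots) (hup : p + A₁ u ∉ X) (hdown : p + A₁ (-u) ∈ X)
    (hnear : ∀ w ∈ fccSlots, ‖A₂ w - A₁ w‖ ≤ 1 / 12) :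
    (X.filter fun q => dist p q = 1).card ≤ 11 := by
  classical
  set Λ₁ : Set (EuclideanSpace ℝ (Fin 3)) := (fun x => A₁ x + t₁) '' fccStacking 1 (Real.sqrt (2 / 3))
    with hΛ₁
  set Λ₂ : Set (EuclideanSpace ℝ (Fin 3)) := (fun x => A₂ x + t₂) '' fccStacking 1 (Real.sqrt (2 / 3))
    with hΛ₂
  have h12 := card_filter_dist_eq_one_le_twelve X hsep p
  by_contra hcon
  have hdeg : (X.filter fun q => dist p q = 1).card = 12 := by omega
  obtain ⟨he₁, he₂, he12⟩ := four_le_card_empty_of_saturated_coincidence_top A₁ A₂ t₁ t₂ p u X hnc hp₁ hp₂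
    hsep hX hu hup hdown hdeg
  -- the relative isometry `L = A₁⁻¹ A₂` and its cubic matrix `M = 1 + κ`
  set L : EuclideanSpace ℝ (Fin 3) ≃ₗᵢ[ℝ] EuclideanSpace ℝ (Fin 3) := A₂.trans A₁.symm with hL
  have hLw : ∀ w, A₁ (L w) = A₂ w := by intro w; simp [hL]
  have hLn : ∀ w, ‖L w - w‖ = ‖A₂ w - A₁ w‖ := by
    intro w; rw [← A₁.norm_map, map_sub, hLw]
  set M : Matrix (Fin 3) (Fin 3) ℝ := Matrix.of fun i j => cubicCoords (L (cubicFrame j)) i with hM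
  have horth : ∀ i j, (M - 1) i j + (M - 1) j i + ∑ l, (M - 1) l i * (M - 1) l j = 0 := cubicMatrix_horth L
  -- ‖κ‖_F² ≤ 1/24 ≤ 1/9
  have hs : Real.sqrt 2 ^ 2 = 2 := Real.sq_sqrt (by norm_num)
  have hs0 : 0 < Real.sqrt 2 := by positivity
  have hslot : ∀ k : Fin 12, ‖L (slotSite k) - slotSite k‖ ≤ 1 / 12 := by
    intro k; rw [hLn]; exact hnear _ (slotSite_mem k)
  have hpair : ∀ (a b : EuclideanSpace ℝ (Fin 3)) (c : EuclideanSpace ℝ (Fin 3)),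
      (c = (1 / Real.sqrt 2) • (a + b) ∨ c = (1 / Real.sqrt 2) • (a - b)) →
      ‖L a - a‖ ≤ 1 / 12 → ‖L b - b‖ ≤ 1 / 12 → ‖L c - c‖ ^ 2 ≤ 1 / 72 := by
    intro a b c hc ha hb
    have key : ‖L c - c‖ ≤ (1 / Real.sqrt 2) * (1 / 12 + 1 / 12) := by
      rcases hc with rfl | rfl
      · have e : L ((1 / Real.sqrt 2) • (a + b)) - (1 / Real.sqrt 2) • (a + b) =
            (1 / Real.sqrt 2) • ((L a - a) + (L b - b)) := by
          rw [L.map_smul, map_add]; simp only [smul_add, smul_sub]; abel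
        rw [e, norm_smul, Real.norm_of_nonneg (by positivity)]
        exact mul_le_mul_of_nonneg_left ((norm_add_le _ _).trans (add_le_add ha hb)) (by positivity)
      · have e : L ((1 / Real.sqrt 2) • (a - b)) - (1 / Real.sqrt 2) • (a - b) =
            (1 / Real.sqrt 2) • ((L a - a) - (L b - b)) := by
          rw [L.map_smul, map_sub]; simp only [smul_sub]; abel
        rw [e, norm_smul, Real.norm_of_nonneg (by positivity)]
        exact mul_le_mul_of_nonneg_left ((norm_sub_le _ _).trans (add_le_add ha hb)) (by positivity)
    have hk : (1 / Real.sqrt 2) * (1 / 12 + 1 / 12) = 1 / (6 * Real.sqrt 2) := by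
      field_simp; ring
    rw [hk] at key
    have hnn : 0 ≤ ‖L c - c‖ := norm_nonneg _
    have : ‖L c - c‖ ^ 2 ≤ (1 / (6 * Real.sqrt 2)) ^ 2 := pow_le_pow_left₀ hnn key 2
    calc ‖L c - c‖ ^ 2 ≤ (1 / (6 * Real.sqrt 2)) ^ 2 := this
      _ = 1 / 72 := by field_simp; rw [hs]; norm_num
  obtain ⟨hc0, hc1, hc2⟩ := cubicFrame_eq_slots
  have hf0 := hpair _ _ _ (Or.inl hc0) (hslot 0) (hslot 1)
  have hf1 := hpair _ _ _ (Or.inr hc1) (hslot 0) (hslot 1)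
  have hf2 := hpair _ _ _ (Or.inr hc2) (hslot 4) (hslot 5)
  have hfrob := cubicMatrix_frob L
  have hsmall : ∑ i, ∑ j, (M - 1) i j ^ 2 ≤ 1 / 9 := by
    rw [hfrob, Fin.sum_univ_three]; linarith
  -- ‖κ‖_F² > 0: otherwise `L = 1`, `A₂ = A₁` on all of `ℝ³`, and the pair is co-axial
  have hpos : 0 < ∑ i, ∑ j, (M - 1) i j ^ 2 := by
    rw [hfrob]
    by_contra h0
    push Not at h0
    have hz : ∀ j, L (cubicFrame j) = cubicFrame j := by
      intro j
      have hle : ‖L (cubicFrame j) - cubicFrame j‖ ^ 2 ≤ 0 := by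
        have := Finset.single_le_sum (f := fun j => ‖L (cubicFrame j) - cubicFrame j‖ ^ 2)
          (fun i _ => sq_nonneg _) (Finset.mem_univ j)
        simpa using this.trans h0
      have : ‖L (cubicFrame j) - cubicFrame j‖ = 0 := by
        nlinarith [norm_nonneg (L (cubicFrame j) - cubicFrame j)]
      exact sub_eq_zero.1 (norm_eq_zero.1 this)
    have hM1 : M = 1 := by
      ext i j
      simp only [hM, Matrix.of_apply, hz, cubicCoords_cubicFrame, Matrix.one_apply, Pi.single_apply]
    have hLid : ∀ x, L x = x := by
      intro x
      apply cubicCoords_injective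
      rw [cubicCoords_map, ← hM, hM1, Matrix.one_mulVec]
    apply hnc
    apply coaxial_of_image_eq A₁ A₂ t₁ t₂
    ext y
    constructor
    · rintro ⟨x, hx, rfl⟩
      refine ⟨L.symm x, ?_, ?_⟩
      · have := hLid (L.symm x); rw [L.apply_symm_apply] at this; rw [← this]; exact hx
      · have := hLw (L.symm x); rw [L.apply_symm_apply] at this; exact this.symm
    · rintro ⟨x, hx, rfl⟩
      exact ⟨x, hx, by rw [← hLw, hLid]⟩
  -- the own-set `S ⊆ Fin 12`
  set S : Finset (Fin 12) := Finset.univ.filter fun k => p + A₁ (slotSite k) ∈ X with hS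
  have he₁' : (fccSlots.filter fun w => p + A₁ w ∉ X).card = (Finset.univ \ S).card := by
    rw [fccSlots_eq_image, Finset.filter_image, Finset.card_image_of_injective _ slotSite_injective,
      hS, Finset.sdiff_eq_filter]
    congr 1
    ext k; simp
  have hScard : S.card + (Finset.univ \ S).card = 12 := by
    have := Finset.card_le_univ S
    rw [Finset.card_univ_sdiff]; simp at this ⊢; omega
  -- the foreign neighbours are the balls on foreign slots `p + A₂ (slotSite k)` off `Λ₁`
  set T : Finset (Fin 12) := Finset.univ.filter fun k => p + A₂ (slotSite k) ∈ X ∧ p + A₂ (slotSite k) ∉ Λ₁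
    with hT
  have hsplit := card_neighbours_eq_occupied_add_foreign A₁ t₁ p X hp₁
  rw [hdeg] at hsplit
  have hocc : (fccSlots.filter fun w => p + A₁ w ∈ X).card = S.card := by
    rw [fccSlots_eq_image, Finset.filter_image, Finset.card_image_of_injective _ slotSite_injective]
  have hforT : (X.filter fun q => dist p q = 1 ∧ q ∉ Λ₁).card = T.card := by
    symm
    refine Finset.card_bij (fun k _ => p + A₂ (slotSite k)) ?_ ?_ ?_
    · intro k hk
      obtain ⟨hkX, hkΛ⟩ := (Finset.mem_filter.1 hk).2
      refine Finset.mem_filter.2 ⟨hkX, ?_, hkΛ⟩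
      rw [dist_eq_norm, sub_add_cancel_left, norm_neg, A₂.norm_map, norm_eq_one_of_mem_fccSlots (slotSite_mem k)]
    · intro k₁ _ k₂ _ h
      exact slotSite_injective (A₂.injective (add_left_cancel h))
    · intro q hq
      obtain ⟨hqX, hd, hqΛ⟩ := Finset.mem_filter.1 hq
      have hq₂ : q ∈ Λ₂ := (hX q hqX hd).resolve_left hqΛ
      have hw := symm_sub_mem_fccSlots A₂ t₂ p q hp₂ hq₂ hd
      obtain ⟨k, hk⟩ := exists_slotSite_eq hw
      have hqk : p + A₂ (slotSite k) = q := by rw [hk]; simp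
      exact ⟨k, Finset.mem_filter.2 ⟨Finset.mem_univ _, by rw [hqk]; exact ⟨hqX, hqΛ⟩⟩, hqk⟩
  -- `T` avoids `S` (an own ball and the foreign ball on the twin slot would be `≤ 1/12` apart)
  have hTS : T ⊆ Finset.univ \ S := by
    intro k hk
    obtain ⟨hkX, hkΛ⟩ := (Finset.mem_filter.1 hk).2
    rw [Finset.mem_sdiff]
    refine ⟨Finset.mem_univ _, fun hkS => ?_⟩
    have hown : p + A₁ (slotSite k) ∈ X := (Finset.mem_filter.1 hkS).2
    have hownΛ : p + A₁ (slotSite k) ∈ Λ₁ := movedFcc_add_site_mem A₁ t₁ hp₁ (mem_fcc_of_mem_fccSlots (slotSite_mem k))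
    have hne : p + A₁ (slotSite k) ≠ p + A₂ (slotSite k) := fun e => hkΛ (e ▸ hownΛ)
    have h1 := hsep _ hown _ hkX hne
    rw [dist_eq_norm, add_sub_add_left_eq_sub, ← norm_neg, neg_sub] at h1
    have := hnear _ (slotSite_mem k)
    linarith
  have hTeq : T = Finset.univ \ S := by
    apply Finset.eq_of_subset_of_card_le hTS
    have : S.card + T.card = 12 := by rw [← hocc, ← hforT]; exact hsplit.symm
    omega
  -- `3 ≤ #S ≤ 9`
  have hcS : (fccSlots.filter fun w => p + A₁ w ∉ X).card = 12 - S.card := by rw [he₁']; omega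
  have h3 : 3 ≤ S.card := by
    -- `#T ≤ #occupied Λ₂-slots = 12 − e₂ ≤ 8`, and `#T = 12 − #S`
    have hT8 : T.card ≤ 8 := by
      have hsub : T ⊆ Finset.univ.filter fun k => p + A₂ (slotSite k) ∈ X := by
        intro k hk
        exact Finset.mem_filter.2 ⟨Finset.mem_univ _, (Finset.mem_filter.1 hk).2.1⟩
      have hocc₂ : (Finset.univ.filter fun k => p + A₂ (slotSite k) ∈ X).card =
          (fccSlots.filter fun w => p + A₂ w ∈ X).card := by
        rw [fccSlots_eq_image, Finset.filter_image, Finset.card_image_of_injective _ slotSite_injective]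
      have h12' : (fccSlots.filter fun w => p + A₂ w ∈ X).card +
          (fccSlots.filter fun w => p + A₂ w ∉ X).card = 12 := by
        rw [Finset.card_filter_add_card_filter_not, card_fccSlots]
      have := Finset.card_le_card hsub
      omega
    rw [hTeq] at hT8
    omega
  have h9 : S.card ≤ 9 := by omega
  -- the cap lemma
  obtain ⟨o, hoS, w, hwS, -, hcut⟩ := near_identity_cut (M - 1) horth hpos hsmall S h3 h9
  have hM' : (1 : Matrix (Fin 3) (Fin 3) ℝ) + (M - 1) = M := by abel
  rw [hM'] at hcut
  -- `slotVec o ⬝ (M *ᵥ slotVec w) = ⟪A₁ s_o, A₂ s_w⟫`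
  have hinner : slotVec o ⬝ᵥ (M *ᵥ slotVec w) = ⟪A₁ (slotSite o), A₂ (slotSite w)⟫_ℝ := by
    rw [← cubicCoords_slotSite, ← cubicCoords_slotSite, ← cubicCoords_map, ← inner_eq_cubicCoords, ← hLw,
      A₁.inner_map_map]
  rw [hinner] at hcut
  -- the two balls
  have hown : p + A₁ (slotSite o) ∈ X := (Finset.mem_filter.1 hoS).2
  have hwT : w ∈ T := by rw [hTeq]; exact Finset.mem_sdiff.2 ⟨Finset.mem_univ _, hwS⟩
  obtain ⟨hfor, hforΛ⟩ := (Finset.mem_filter.1 hwT).2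
  have hownΛ : p + A₁ (slotSite o) ∈ Λ₁ := movedFcc_add_site_mem A₁ t₁ hp₁ (mem_fcc_of_mem_fccSlots (slotSite_mem o))
  have hne : p + A₁ (slotSite o) ≠ p + A₂ (slotSite w) := fun e => hforΛ (e ▸ hownΛ)
  have h1 := hsep _ hown _ hfor hne
  rw [dist_eq_norm, add_sub_add_left_eq_sub] at h1
  have hsq : ‖A₁ (slotSite o) - A₂ (slotSite w)‖ ^ 2 =
      ‖A₁ (slotSite o)‖ ^ 2 - 2 * ⟪A₁ (slotSite o), A₂ (slotSite w)⟫_ℝ + ‖A₂ (slotSite w)‖ ^ 2 :=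
    norm_sub_sq_real _ _
  rw [A₁.norm_map, A₂.norm_map, norm_eq_one_of_mem_fccSlots (slotSite_mem o),
    norm_eq_one_of_mem_fccSlots (slotSite_mem w)] at hsq
  nlinarith [h1, hsq, hcut, norm_nonneg (A₁ (slotSite o) - A₂ (slotSite w))]


/-- Precomposing the frame with a lattice symmetry does not change the grain. -/
theorem image_comp_latticeIsometry
    (A : EuclideanSpace ℝ (Fin 3) ≃ₗᵢ[ℝ] EuclideanSpace ℝ (Fin 3)) (t : EuclideanSpace ℝ (Fin 3))
    (g : EuclideanSpace ℝ (Fin 3) ≃ₗᵢ[ℝ] EuclideanSpace ℝ (Fin 3))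
    (hg : g '' fccStacking 1 (Real.sqrt (2 / 3)) = fccStacking 1 (Real.sqrt (2 / 3))) :
    (fun x => (g.trans A) x + t) '' fccStacking 1 (Real.sqrt (2 / 3)) =
      (fun x => A x + t) '' fccStacking 1 (Real.sqrt (2 / 3)) := by
  ext y
  simp only [Set.mem_image, LinearIsometryEquiv.coe_trans, Function.comp_apply]
  constructor
  · rintro ⟨x, hx, rfl⟩
    exact ⟨g x, by rw [← hg]; exact ⟨x, hx, rfl⟩, rfl⟩
  · rintro ⟨x, hx, rfl⟩
    rw [← hg] at hx
    obtain ⟨z, hz, rfl⟩ := hx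
    exact ⟨z, hz, rfl⟩

open scoped Classical in
/-- **Σ1 cap lemma, lattice form, up to a lattice symmetry.**  As
`coincidence_top_unsaturated_near_identity`, but the second frame need only be close to the first AFTER
precomposition with a linear isometry `g` preserving `Λ₀` (one of the 48 point symmetries):
`‖A₂ (g w) − A₁ w‖ ≤ 1/12` for all slots `w`.  (The grain `A₂·Λ₀ + t₂` and the co-axiality hypothesis are
unchanged under `A₂ ↦ A₂ ∘ g`.) -/
theorem coincidence_top_unsaturated_near_symmetry
    (A₁ A₂ g : EuclideanSpace ℝ (Fin 3) ≃ₗᵢ[ℝ] EuclideanSpace ℝ (Fin 3))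
    (hg : g '' fccStacking 1 (Real.sqrt (2 / 3)) = fccStacking 1 (Real.sqrt (2 / 3)))
    (t₁ t₂ p u : EuclideanSpace ℝ (Fin 3)) (X : Finset (EuclideanSpace ℝ (Fin 3)))
    (hnc : ¬ ∃ (L : EuclideanSpace ℝ (Fin 3) ≃ₗᵢ[ℝ] EuclideanSpace ℝ (Fin 3))
        (s₁ s₂ : EuclideanSpace ℝ (Fin 3)) (σ σ' : ℤ → ℤ), IsHaggSeq σ ∧ IsHaggSeq σ' ∧
        (fun x => A₁ x + t₁) '' fccStacking 1 (Real.sqrt (2 / 3)) ⊆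
          (fun x => L x + s₁) '' barlowStacking 1 (Real.sqrt (2 / 3)) σ ∧
        (fun x => A₂ x + t₂) '' fccStacking 1 (Real.sqrt (2 / 3)) ⊆
          (fun x => L x + s₂) '' barlowStacking 1 (Real.sqrt (2 / 3)) σ')
    (hp₁ : p ∈ (fun x => A₁ x + t₁) '' fccStacking 1 (Real.sqrt (2 / 3)))
    (hp₂ : p ∈ (fun x => A₂ x + t₂) '' fccStacking 1 (Real.sqrt (2 / 3)))
    (hsep : ∀ x ∈ X, ∀ y ∈ X, x ≠ y → 1 ≤ dist x y)
    (hX : ∀ q ∈ X, dist p q = 1 → q ∈ (fun x => A₁ x + t₁) '' fccStacking 1 (Real.sqrt (2 / 3)) ∨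
      q ∈ (fun x => A₂ x + t₂) '' fccStacking 1 (Real.sqrt (2 / 3)))
    (hu : u ∈ fccSlots) (hup : p + A₁ u ∉ X) (hdown : p + A₁ (-u) ∈ X)
    (hnear : ∀ w ∈ fccSlots, ‖A₂ (g w) - A₁ w‖ ≤ 1 / 12) :
    (X.filter fun q => dist p q = 1).card ≤ 11 := by
  have himg := image_comp_latticeIsometry A₂ t₂ g hg
  refine coincidence_top_unsaturated_near_identity A₁ (g.trans A₂) t₁ t₂ p u X ?_ hp₁ ?_ hsep ?_ hu hup hdown ?_
  · rw [himg]; exact hnc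
  · rw [himg]; exact hp₂
  · rw [himg]; exact hX
  · intro w hw; simpa using hnear w hw

end Summit.Ventures.Crystal3D.Theorems

end
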